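import Mathlib
import HarnessLib
import Summits.ValiantsHypothesis.ValiantsHypothesis.Theorems.LacunarySymmetroidMatrixDescartesProductPlusOneLowerSignedCalculus

/-!
# ValiantsHypothesis / LacunarySymmetroid — crux `MatrixDescartes` (stmt-ValiantsHypothesis-18050, V1),
# LINE (A) «product_plus_one», S4″/S5 Euler currency: the LOWER-SIGNED SECTOR — every K, every support, no side condition

Builds on `…ProductPlusOneLowerSignedCalculus` (`hasDerivAt_lowerSignedXi`: in the TOP chart `t = x^{d_{K−1}−d_0}` the weighted level
function `Ξ_j = (X f_j′ − d_0 f_j)/(x^w f_j)`, `w = d_{K−1} − d_0`, of a LOWER-SIGNED factor — coefficients below the top letter weakly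
one-signed, top coefficient free, zeros allowed — has a nonpositive derivative, negative unless `f_j = a_0 X^{d_0}`).  This file draws the
counts at the bottom coupling `l₀ = 0`, for EVERY format `K ≥ 2` and every strictly increasing support, with NO further hypothesis:

* `lowerSigned_pos_roots_le_one` / `prod_lowerSigned_pos_roots_le` — a nonzero lower-signed factor has at most one positive zero, the
  product of `m` of them at most `m`;
* `lowerSignedK_euler_pos_roots` — range-indexed shape: `Z₊(X·P′ − (m d_0)·P) ≤ 2m + 1` (a vanishing factor or all factors bottom
  monomials ⇒ the numerator is the zero polynomial; otherwise `Σ_j Ξ_j` is strictly decreasing on zero-free intervals and Rolle via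
  ✓ `euler_pos_roots_le_general`);
* ★★ `eulerBound_lowerSignedK` — LINE SHAPE (unfolded verbatim as in ✓ `eulerBound_coherentK`): `Z₊(eulerNumerator d a 0) ≤ 2m + 1`;
* ★ `lowerSigned_sector_classK` — members: `Z₊(C c·X^{m d_0} + ∏ f_j) ≤ 2m + 2` (✓ `card_pos_roots_class_le_euler`);
* `eulerBoundK3_lowerSigned` / `classRowK3_lowerSigned` — the `K = 3` rows (`d 0 < d 1 < d 2`; `a_{j0}, a_{j1}` weakly one-signed per
  factor, `a_{j2}` free).

So ONE sector contains the positive-coefficient rung S3 (in Euler currency), the coherent one-zero sector of ✓ `…CoherentK` and all their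
MIXTURES (zero-free one-signed factors in the company of coherent one-zero factors), plus degenerate binomial/monomial factors — the two
`example`s at the end record the specialisations.  Residue of `stub_classRowK3` / `stub_polyLaw` after this file: zero-free strict dips
`(+,−,+)`, INCOHERENT one-zero factors at ratio > 4 (and their mixtures), the middle coupling; the top-coupling mirror («upper-signed»
factors) follows by reversal (separate file).
Honest framing: a sector rung of the research stubs; NOT `stub_eulerBoundK3` / `stub_classRowK3` / `stub_polyLaw` / `MatrixDescartes` / B;
`VP ≠ VNP` NOT proved.  No definitions, no named facts.
-/

set_option linter.dupNamespace false

namespace Summit.ValiantsHypothesis.ValiantsHypothesis.Theorems.LacunarySymmetroidMatrixDescartes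

namespace ProductPlusOne

open Polynomial Finset
open scoped BigOperators


/-! ### §C A lower-signed factor has at most one positive zero; the product -/

/-- A nonzero lower-signed sparse factor has at most ONE positive zero (`f/x^{d_T} = Σ_{i<T} c_i x^{−(d_T−d_i)} + c_T` is monotone, strictly
unless `f` is a top monomial). [folklore] -/
theorem lowerSigned_pos_roots_le_one (T : ℕ) (d : ℕ → ℕ) (hd : StrictMono d) (c : ℕ → ℝ)
    (hls : (∀ i, i < T → 0 ≤ c i) ∨ (∀ i, i < T → c i ≤ 0))
    (hf0 : (∑ i ∈ Finset.range (T + 1), C (c i) * X ^ (d i) : ℝ[X]) ≠ 0) :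
    (((∑ i ∈ Finset.range (T + 1), C (c i) * X ^ (d i) : ℝ[X])).roots.toFinset.filter (fun t => 0 < t)).card ≤ 1 := by
  classical
  -- reduce to nonnegative lower coefficients (`roots (−f) = roots f`)
  wlog hnn : ∀ i, i < T → 0 ≤ c i generalizing c
  · have hneg : ∀ i, i < T → 0 ≤ -c i := by
      rcases hls with h | h
      · exact absurd h hnn
      · exact fun i hi => by linarith [h i hi]
    have hrel : (∑ i ∈ Finset.range (T + 1), C (-c i) * X ^ (d i) : ℝ[X])
        = -(∑ i ∈ Finset.range (T + 1), C (c i) * X ^ (d i)) := by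
      rw [← Finset.sum_neg_distrib]
      exact Finset.sum_congr rfl fun i _ => by rw [C_neg, neg_mul]
    have h := this (fun i => -c i) (Or.inl hneg) (by rw [hrel]; exact neg_ne_zero.2 hf0) hneg
    rwa [hrel, roots_neg] at h
  -- `h(x) = Σ_{i<T} c_i / x^{d_T − d_i}`
  set h : ℝ → ℝ := fun x => ∑ i ∈ Finset.range T, c i / x ^ (d T - d i) with hh
  have hrel : ∀ z : ℝ, 0 < z → (∑ i ∈ Finset.range (T + 1), C (c i) * X ^ (d i) : ℝ[X]).eval z = z ^ (d T) * (h z + c T) := by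
    intro z hz
    simp only [eval_finsetSum, eval_mul, eval_C, eval_pow, eval_X, hh]
    rw [Finset.sum_range_succ, mul_add, Finset.mul_sum]
    congr 1
    swap
    · ring
    refine Finset.sum_congr rfl fun i hi => ?_
    rw [Finset.mem_range] at hi
    have hle : d i ≤ d T := hd.monotone hi.le
    have hzz : z ^ d i * z ^ (d T - d i) = z ^ d T := by rw [← pow_add, Nat.add_sub_cancel' hle]
    rw [mul_div_assoc', eq_div_iff (pow_ne_zero _ hz.ne')]
    linear_combination (c i) * hzz
  by_cases hlow : ∃ i, i < T ∧ c i ≠ 0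
  · -- a lower coefficient is positive: `h` is strictly decreasing
    obtain ⟨i₁, hi₁, hci₁⟩ := hlow
    have hc1 : 0 < c i₁ := lt_of_le_of_ne (hnn i₁ hi₁) (Ne.symm hci₁)
    have hmono : ∀ x y : ℝ, 0 < x → x < y → h y < h x := by
      intro x y hx hxy
      rw [hh]
      apply Finset.sum_lt_sum
      · intro i hi
        rw [Finset.mem_range] at hi
        have hk : 1 ≤ d T - d i := Nat.sub_pos_of_lt (hd hi)
        have hpow : x ^ (d T - d i) ≤ y ^ (d T - d i) := (pow_lt_pow_left₀ hxy hx.le (by omega)).le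
        exact div_le_div_of_nonneg_left (hnn i hi) (pow_pos hx _) hpow
      · refine ⟨i₁, Finset.mem_range.2 hi₁, ?_⟩
        have hpow : x ^ (d T - d i₁) < y ^ (d T - d i₁) :=
          pow_lt_pow_left₀ hxy hx.le (by have := Nat.sub_pos_of_lt (hd hi₁); omega)
        exact div_lt_div_of_pos_left hc1 (pow_pos hx _) hpow
    rw [Finset.card_le_one]
    intro z₁ hz₁ z₂ hz₂
    rw [Finset.mem_filter, Multiset.mem_toFinset, mem_roots hf0, IsRoot.def] at hz₁ hz₂
    have e1 : h z₁ + c T = 0 := by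
      have := hz₁.1; rw [hrel z₁ hz₁.2] at this
      exact (mul_eq_zero.1 this).resolve_left (pow_ne_zero _ hz₁.2.ne')
    have e2 : h z₂ + c T = 0 := by
      have := hz₂.1; rw [hrel z₂ hz₂.2] at this
      exact (mul_eq_zero.1 this).resolve_left (pow_ne_zero _ hz₂.2.ne')
    have heq : h z₁ = h z₂ := by linarith
    by_contra hne
    rcases lt_or_gt_of_ne hne with hlt | hlt
    · have hm' := hmono z₁ z₂ hz₁.2 hlt; rw [heq] at hm'; exact lt_irrefl _ hm'
    · have hm' := hmono z₂ z₁ hz₂.2 hlt; rw [heq] at hm'; exact lt_irrefl _ hm'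
  · -- only the top coefficient: `f = c_T X^{d_T}` has no positive zero
    push Not at hlow
    have hfm : (∑ i ∈ Finset.range (T + 1), C (c i) * X ^ (d i) : ℝ[X]) = C (c T) * X ^ (d T) := by
      rw [Finset.sum_range_succ]
      have : ∑ i ∈ Finset.range T, C (c i) * X ^ (d i) = (0 : ℝ[X]) :=
        Finset.sum_eq_zero fun i hi => by rw [hlow i (Finset.mem_range.1 hi)]; simp
      rw [this, zero_add]
    have hcT : c T ≠ 0 := by
      intro h0; apply hf0; rw [hfm, h0]; simp
    have hempty : ((∑ i ∈ Finset.range (T + 1), C (c i) * X ^ (d i) : ℝ[X]).roots.toFinset.filter (fun t => 0 < t)) = ∅ := by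
      rw [hfm, roots_C_mul_X_pow hcT]
      ext t
      simp only [Finset.mem_filter, Multiset.mem_toFinset, Multiset.mem_nsmul, Multiset.mem_singleton,
        Finset.notMem_empty, iff_false, not_and, not_lt]
      rintro ⟨_, rfl⟩
      exact le_rfl
    rw [hempty]; simp

/-- The product of `m` nonzero lower-signed factors: nonzero, at most `m` positive zeros. [folklore] -/
theorem prod_lowerSigned_pos_roots_le {m : ℕ} (T : ℕ) (d : ℕ → ℕ) (hd : StrictMono d) (c : Fin m → ℕ → ℝ)
    (hls : ∀ j, (∀ i, i < T → 0 ≤ c j i) ∨ (∀ i, i < T → c j i ≤ 0))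
    (hP0 : (∏ j, (∑ i ∈ Finset.range (T + 1), C (c j i) * X ^ (d i) : ℝ[X])) ≠ 0) :
    ((∏ j, (∑ i ∈ Finset.range (T + 1), C (c j i) * X ^ (d i) : ℝ[X])).roots.toFinset.filter
      (fun t => 0 < t)).card ≤ m := by
  classical
  have hf0 : ∀ j, (∑ i ∈ Finset.range (T + 1), C (c j i) * X ^ (d i) : ℝ[X]) ≠ 0 :=
    fun j => (Finset.prod_ne_zero_iff.1 hP0) j (Finset.mem_univ _)
  have hone := fun j => lowerSigned_pos_roots_le_one T d hd (c j) (hls j) (hf0 j)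
  have hsub : ((∏ j, (∑ i ∈ Finset.range (T + 1), C (c j i) * X ^ (d i) : ℝ[X])).roots.toFinset.filter (fun t => 0 < t))
      ⊆ Finset.univ.biUnion (fun j =>
        ((∑ i ∈ Finset.range (T + 1), C (c j i) * X ^ (d i) : ℝ[X]).roots.toFinset.filter (fun t => 0 < t))) := by
    intro x hx
    rw [mem_filter, Multiset.mem_toFinset, mem_roots hP0, IsRoot.def, eval_prod, Finset.prod_eq_zero_iff] at hx
    obtain ⟨⟨j, _, hj⟩, hx0⟩ := hx
    rw [mem_biUnion]
    refine ⟨j, mem_univ _, ?_⟩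
    rw [mem_filter, Multiset.mem_toFinset, mem_roots (hf0 j), IsRoot.def]
    exact ⟨hj, hx0⟩
  refine (card_le_card hsub).trans (card_biUnion_le.trans ?_)
  calc ∑ j, (((∑ i ∈ Finset.range (T + 1), C (c j i) * X ^ (d i) : ℝ[X]).roots.toFinset.filter (fun t => 0 < t))).card
      ≤ ∑ _j : Fin m, 1 := Finset.sum_le_sum (fun j _ => hone j)
    _ = m := by simp

/-! ### §D The Euler count: lower-signed members, every format -/

/-- ★ **Lower-signed `(T+1)`-nomials on a common support, bottom coupling**: `Z₊(X·P′ − (m·d_0)·P) ≤ 2m + 1` (`T ≥ 1`), with NO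
nonvanishing hypothesis. [this file's theorem] -/
theorem lowerSignedK_euler_pos_roots {m : ℕ} (T : ℕ) (hT : 1 ≤ T) (d : ℕ → ℕ) (hd : StrictMono d) (c : Fin m → ℕ → ℝ)
    (hls : ∀ j, (∀ i, i < T → 0 ≤ c j i) ∨ (∀ i, i < T → c j i ≤ 0)) :
    ((X * derivative (∏ j, (∑ i ∈ Finset.range (T + 1), C (c j i) * X ^ (d i) : ℝ[X]))
        - C ((m : ℝ) * (d 0 : ℝ)) * ∏ j, (∑ i ∈ Finset.range (T + 1), C (c j i) * X ^ (d i) : ℝ[X])).roots.toFinset.filter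
      (fun t => 0 < t)).card ≤ 2 * m + 1 := by
  classical
  rcases Nat.eq_zero_or_pos m with hm | hm
  · subst hm
    simp only [Finset.univ_eq_empty, Finset.prod_empty, derivative_one, mul_zero, zero_sub, mul_one, roots_neg,
      Nat.cast_zero, zero_mul, roots_C, Multiset.toFinset_zero, Finset.filter_empty, Finset.card_empty]
    exact Nat.zero_le _
  -- a vanishing factor: everything is the zero polynomial
  by_cases hP0 : (∏ j, (∑ i ∈ Finset.range (T + 1), C (c j i) * X ^ (d i) : ℝ[X])) = 0
  · rw [hP0]; simp
  -- every factor a bottom monomial: the Euler numerator vanishes identically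
  by_cases hdeg : ∃ j, ∃ i, 0 < i ∧ i < T + 1 ∧ c j i ≠ 0
  swap
  · push Not at hdeg
    have hfac : ∀ j, (∑ i ∈ Finset.range (T + 1), C (c j i) * X ^ (d i) : ℝ[X]) = C (c j 0) * X ^ (d 0) := by
      intro j
      rw [Finset.sum_range_succ']
      have : ∑ i ∈ Finset.range T, C (c j (i + 1)) * X ^ (d (i + 1)) = (0 : ℝ[X]) :=
        Finset.sum_eq_zero fun i hi => by
          rw [hdeg j (i + 1) (Nat.succ_pos i) (by have := Finset.mem_range.1 hi; omega)]; simp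
      rw [this, zero_add]
    have hP : (∏ j, (∑ i ∈ Finset.range (T + 1), C (c j i) * X ^ (d i) : ℝ[X])) = C (∏ j, c j 0) * X ^ (m * d 0) := by
      rw [Finset.prod_congr rfl (fun j _ => hfac j), Finset.prod_mul_distrib, map_prod C, Finset.prod_const,
        Finset.card_univ, Fintype.card_fin, ← pow_mul]
      ring_nf
    have hE0 : (X * derivative (∏ j, (∑ i ∈ Finset.range (T + 1), C (c j i) * X ^ (d i) : ℝ[X]))
        - C ((m : ℝ) * (d 0 : ℝ)) * ∏ j, (∑ i ∈ Finset.range (T + 1), C (c j i) * X ^ (d i) : ℝ[X])) = 0 := by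
      rw [hP]
      have hc : ((m : ℝ) * (d 0 : ℝ)) = ((m * d 0 : ℕ) : ℝ) := by push_cast; ring
      rw [hc]
      ext n
      rw [coeff_euler, coeff_zero, coeff_C_mul, coeff_X_pow]
      split_ifs with hn
      · rw [hn]; push_cast; ring
      · ring
    rw [hE0]; simp
  obtain ⟨j₀, i₀, hi₀0, hi₀T, hci₀⟩ := hdeg
  have hZ := prod_lowerSigned_pos_roots_le T d hd c hls hP0
  have hf0 : ∀ j, (∑ i ∈ Finset.range (T + 1), C (c j i) * X ^ (d i) : ℝ[X]) ≠ 0 :=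
    fun j => (Finset.prod_ne_zero_iff.1 hP0) j (Finset.mem_univ _)
  set w : ℕ := d T - d 0 with hw
  have h := euler_pos_roots_le_general (fun j => (∑ i ∈ Finset.range (T + 1), C (c j i) * X ^ (d i) : ℝ[X])) hP0
    ((m : ℝ) * (d 0 : ℝ)) m hZ ?_
  · exact h.trans (by omega)
  · intro w₁ w₂ hw₁ hw12 hfree h1 h2
    -- rewrite the level condition as `Ξ(w_i) = 0`
    set Ξ : ℝ → ℝ := fun y => ∑ j, (X * derivative (∑ i ∈ Finset.range (T + 1), C (c j i) * X ^ (d i) : ℝ[X])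
        - C ((d 0 : ℕ) : ℝ) * ∑ i ∈ Finset.range (T + 1), C (c j i) * X ^ (d i)).eval y
        / (y ^ (d T - d 0) * (∑ i ∈ Finset.range (T + 1), C (c j i) * X ^ (d i) : ℝ[X]).eval y) with hΞ
    have hlevel : ∀ y : ℝ, 0 < y → (∀ j, (∑ i ∈ Finset.range (T + 1), C (c j i) * X ^ (d i) : ℝ[X]).eval y ≠ 0) →
        (∑ j, y * (derivative (∑ i ∈ Finset.range (T + 1), C (c j i) * X ^ (d i) : ℝ[X])).eval y
            / (∑ i ∈ Finset.range (T + 1), C (c j i) * X ^ (d i) : ℝ[X]).eval y) = (m : ℝ) * (d 0 : ℝ) →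
        Ξ y = 0 := by
      intro y hy hfy hl
      have hyw : y ^ (d T - d 0) ≠ 0 := pow_ne_zero _ hy.ne'
      have key : Ξ y * y ^ (d T - d 0)
          = (∑ j, y * (derivative (∑ i ∈ Finset.range (T + 1), C (c j i) * X ^ (d i) : ℝ[X])).eval y
            / (∑ i ∈ Finset.range (T + 1), C (c j i) * X ^ (d i) : ℝ[X]).eval y) - (m : ℝ) * (d 0 : ℝ) := by
        rw [hΞ]; simp only
        rw [Finset.sum_mul]
        have : ((m : ℝ) * (d 0 : ℝ)) = ∑ _j : Fin m, ((d 0 : ℕ) : ℝ) := by simp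
        rw [this, ← Finset.sum_sub_distrib]
        refine Finset.sum_congr rfl fun j _ => ?_
        have hfj := hfy j
        simp only [eval_sub, eval_mul, eval_X, eval_C]
        field_simp
      rw [hl, sub_self] at key
      exact (mul_eq_zero.1 key).resolve_right hyw
    have hΞ1 : Ξ w₁ = 0 := hlevel w₁ hw₁ (fun j => hfree w₁ ⟨le_rfl, hw12.le⟩ j) h1
    have hΞ2 : Ξ w₂ = 0 := hlevel w₂ (hw₁.trans hw12) (fun j => hfree w₂ ⟨hw12.le, le_rfl⟩ j) h2
    -- `Ξ` has a negative derivative on `[w₁, w₂]` (factor `j₀` is not a bottom monomial): Rolle gives a contradiction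
    have hderiv : ∀ t ∈ Set.Icc w₁ w₂, ∃ D : ℝ, D < 0 ∧ HasDerivAt Ξ D t := by
      intro t ht
      have ht0 : 0 < t := hw₁.trans_le ht.1
      choose D hD using fun j => hasDerivAt_lowerSignedXi T hT d hd (c j) (hls j) ht0 (hfree t ht j)
      refine ⟨∑ j, D j, ?_, ?_⟩
      · calc ∑ j, D j < ∑ _j : Fin m, (0 : ℝ) :=
            Finset.sum_lt_sum (fun j _ => (hD j).1) ⟨j₀, Finset.mem_univ _, (hD j₀).2.1 ⟨i₀, hi₀0, hi₀T, hci₀⟩⟩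
          _ = 0 := by simp
      · have := HasDerivAt.fun_sum (u := Finset.univ) (fun j _ => (hD j).2.2)
        rw [hΞ]; exact this
    have hcont : ContinuousOn Ξ (Set.Icc w₁ w₂) := fun t ht => by
      obtain ⟨D, _, hD⟩ := hderiv t ht
      exact hD.continuousAt.continuousWithinAt
    obtain ⟨ξ, hξ, hξ'⟩ := exists_deriv_eq_zero hw12 hcont (hΞ1.trans hΞ2.symm)
    obtain ⟨D, hDneg, hD⟩ := hderiv ξ ⟨hξ.1.le, hξ.2.le⟩
    rw [hD.deriv] at hξ'
    exact hDneg.ne hξ'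

/-! ### §E Line shapes -/

/-- ★★ **THE LOWER-SIGNED SECTOR, EVERY FORMAT** (line shape; `2 ≤ K`, `d` strictly increasing, bottom coupling `l₀ = 0`, every factor with
its coefficients below the top letter weakly one-signed — top coefficient free, zeros allowed): `Z₊(eulerNumerator d a 0) ≤ 2m + 1`.
[this file's theorem] -/
theorem eulerBound_lowerSignedK {m K : ℕ} (hK : 2 ≤ K) (d : Fin K → ℕ) (hd : StrictMono d) (a : Fin m → Fin K → ℝ)
    (hls : ∀ j, (∀ l : Fin K, (l : ℕ) < K - 1 → 0 ≤ a j l) ∨ (∀ l : Fin K, (l : ℕ) < K - 1 → a j l ≤ 0)) :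
    ((∑ j, (∑ l, C (a j l * ((d l : ℝ) - d ⟨0, by omega⟩)) * X ^ (d l)) * ∏ i ∈ Finset.univ.erase j, (∑ l, C (a i l) * X ^ (d l))
      : ℝ[X]).roots.toFinset.filter (fun t => 0 < t)).card ≤ 2 * m + 1 := by
  classical
  obtain ⟨K', rfl⟩ : ∃ K', K = K' + 1 := ⟨K - 1, by omega⟩
  have hK' : 1 ≤ K' := by omega
  set dx : ℕ → ℕ := fun i => if h : i < K' + 1 then d ⟨i, h⟩ else d ⟨K', by omega⟩ + (i - K') with hdx
  set cx : Fin m → ℕ → ℝ := fun j i => if h : i < K' + 1 then a j ⟨i, h⟩ else 0 with hcx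
  have hdx_in : ∀ i (h : i < K' + 1), dx i = d ⟨i, h⟩ := fun i h => by simp only [hdx]; exact dif_pos h
  have hdmono : StrictMono dx := by
    intro i j hij
    by_cases hj : j < K' + 1
    · have hi : i < K' + 1 := by omega
      rw [hdx_in i hi, hdx_in j hj]
      exact hd (Fin.mk_lt_mk.mpr hij)
    · have ej : dx j = d ⟨K', by omega⟩ + (j - K') := by simp only [hdx]; exact dif_neg hj
      rw [ej]
      by_cases hi : i < K' + 1
      · rw [hdx_in i hi]
        have : d ⟨i, hi⟩ ≤ d ⟨K', by omega⟩ := hd.monotone (Fin.mk_le_mk.mpr (by omega))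
        omega
      · have ei : dx i = d ⟨K', by omega⟩ + (i - K') := by simp only [hdx]; exact dif_neg hi
        rw [ei]
        omega
  have hfac : ∀ j, (∑ l, C (a j l) * X ^ (d l) : ℝ[X]) = ∑ i ∈ Finset.range (K' + 1), C (cx j i) * X ^ (dx i) := by
    intro j
    rw [← Fin.sum_univ_eq_sum_range (fun i => C (cx j i) * X ^ (dx i)) (K' + 1)]
    refine Finset.sum_congr rfl (fun l _ => ?_)
    have hl : (l : ℕ) < K' + 1 := l.isLt
    simp only [hcx, hdx, dif_pos hl, Fin.eta]
  have hls' : ∀ j, (∀ i, i < K' → 0 ≤ cx j i) ∨ (∀ i, i < K' → cx j i ≤ 0) := by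
    intro j
    rcases hls j with h | h
    · refine Or.inl fun i hi => ?_
      simp only [hcx, dif_pos (show i < K' + 1 by omega)]
      exact h ⟨i, by omega⟩ (by simpa using hi)
    · refine Or.inr fun i hi => ?_
      simp only [hcx, dif_pos (show i < K' + 1 by omega)]
      exact h ⟨i, by omega⟩ (by simpa using hi)
  rw [eulerNumerator_eq_general, Finset.prod_congr rfl (fun j _ => hfac j)]
  have h0 : ((d ⟨0, by omega⟩ : ℕ) : ℝ) = (dx 0 : ℝ) := by rw [hdx_in 0 (by omega)]
  rw [h0]
  exact lowerSignedK_euler_pos_roots K' hK' dx hdmono cx hls'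

/-- ★ **THE LOWER-SIGNED SECTOR, member count, EVERY FORMAT** (line shape, bottom coupling `l₀ = 0`): `Z₊(C c·X^{m d 0} + ∏ f_j) ≤ 2m + 2`
(✓ `card_pos_roots_class_le_euler` + `eulerBound_lowerSignedK`). [this file's theorem] -/
theorem lowerSigned_sector_classK {m K : ℕ} (hK : 2 ≤ K) (d : Fin K → ℕ) (hd : StrictMono d) (a : Fin m → Fin K → ℝ)
    (hls : ∀ j, (∀ l : Fin K, (l : ℕ) < K - 1 → 0 ≤ a j l) ∨ (∀ l : Fin K, (l : ℕ) < K - 1 → a j l ≤ 0)) (c : ℝ) :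
    ((C c * X ^ (m * d ⟨0, by omega⟩) + ∏ j, ∑ l, C (a j l) * X ^ (d l) : ℝ[X]).roots.toFinset.filter (fun t => 0 < t)).card
      ≤ 2 * m + 2 :=
  (card_pos_roots_class_le_euler d a ⟨0, by omega⟩ c).trans (by have := eulerBound_lowerSignedK hK d hd a hls; omega)

/-- **The `K = 3` row, Euler currency** (`d 0 < d 1 < d 2`, bottom coupling, `a_{j0}` and `a_{j1}` weakly one-signed per factor, `a_{j2}` free):
`Z₊(eulerNumerator d a 0) ≤ 2m + 1`. [this file's theorem] -/
theorem eulerBoundK3_lowerSigned {m : ℕ} (d : Fin 3 → ℕ) (h01 : d 0 < d 1) (h12 : d 1 < d 2)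
    (a : Fin m → Fin 3 → ℝ) (hls : ∀ j, (0 ≤ a j 0 ∧ 0 ≤ a j 1) ∨ (a j 0 ≤ 0 ∧ a j 1 ≤ 0)) :
    ((∑ j, (∑ l, C (a j l * ((d l : ℝ) - d 0)) * X ^ (d l)) * ∏ i ∈ Finset.univ.erase j, (∑ l, C (a i l) * X ^ (d l))
      : ℝ[X]).roots.toFinset.filter (fun t => 0 < t)).card ≤ 2 * m + 1 := by
  have hd : StrictMono d := by
    refine Fin.strictMono_iff_lt_succ.2 fun i => ?_
    fin_cases i
    · exact h01
    · exact h12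
  have hls' : ∀ j, (∀ l : Fin 3, (l : ℕ) < 3 - 1 → 0 ≤ a j l) ∨ (∀ l : Fin 3, (l : ℕ) < 3 - 1 → a j l ≤ 0) := by
    intro j
    rcases hls j with ⟨h0, h1⟩ | ⟨h0, h1⟩
    · refine Or.inl fun l hl => ?_
      fin_cases l
      · exact h0
      · exact h1
      · simp at hl
    · refine Or.inr fun l hl => ?_
      fin_cases l
      · exact h0
      · exact h1
      · simp at hl
  exact eulerBound_lowerSignedK (by norm_num) d hd a hls'

/-- **The `K = 3` row, member count** (bottom coupling): `Z₊(C c·X^{m d 0} + ∏ f_j) ≤ 2m + 2`. [this file's theorem] -/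
theorem classRowK3_lowerSigned {m : ℕ} (d : Fin 3 → ℕ) (h01 : d 0 < d 1) (h12 : d 1 < d 2)
    (a : Fin m → Fin 3 → ℝ) (hls : ∀ j, (0 ≤ a j 0 ∧ 0 ≤ a j 1) ∨ (a j 0 ≤ 0 ∧ a j 1 ≤ 0)) (c : ℝ) :
    ((C c * X ^ (m * d 0) + ∏ j, ∑ l, C (a j l) * X ^ (d l) : ℝ[X]).roots.toFinset.filter (fun t => 0 < t)).card
      ≤ 2 * m + 2 :=
  (card_pos_roots_class_le_euler d a 0 c).trans (by have := eulerBoundK3_lowerSigned d h01 h12 a hls; omega)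

/-- the positive-coefficient rung in Euler currency, every format (special case: all top coefficients ≥ 0 too). -/
example {m K : ℕ} (hK : 2 ≤ K) (d : Fin K → ℕ) (hd : StrictMono d) (a : Fin m → Fin K → ℝ) (ha : ∀ j l, 0 ≤ a j l) :
    ((∑ j, (∑ l, C (a j l * ((d l : ℝ) - d ⟨0, by omega⟩)) * X ^ (d l)) * ∏ i ∈ Finset.univ.erase j, (∑ l, C (a i l) * X ^ (d l))
      : ℝ[X]).roots.toFinset.filter (fun t => 0 < t)).card ≤ 2 * m + 1 :=
  eulerBound_lowerSignedK hK d hd a (fun j => Or.inl fun l _ => ha j l)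

/-- the coherent one-zero sector of ✓ `eulerBound_coherentK` is a special case (strict signs, top opposite). -/
example {m K : ℕ} (hK : 3 ≤ K) (d : Fin K → ℕ) (hd : StrictMono d) (a : Fin m → Fin K → ℝ)
    (hcoh : ∀ j (l : Fin K), (l : ℕ) < K - 1 → 0 < a j ⟨0, by omega⟩ * a j l) :
    ((∑ j, (∑ l, C (a j l * ((d l : ℝ) - d ⟨0, by omega⟩)) * X ^ (d l)) * ∏ i ∈ Finset.univ.erase j, (∑ l, C (a i l) * X ^ (d l))
      : ℝ[X]).roots.toFinset.filter (fun t => 0 < t)).card ≤ 2 * m + 1 := by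
  refine eulerBound_lowerSignedK (by omega) d hd a fun j => ?_
  have h00 := hcoh j ⟨0, by omega⟩ (by simp; omega)
  rcases lt_or_gt_of_ne (show a j ⟨0, by omega⟩ ≠ 0 from fun h => by rw [h, zero_mul] at h00; exact lt_irrefl 0 h00) with hneg | hpos
  · exact Or.inr fun l hl => by have := hcoh j l hl; nlinarith
  · exact Or.inl fun l hl => by have := hcoh j l hl; nlinarith

end ProductPlusOne

end Summit.ValiantsHypothesis.ValiantsHypothesis.Theorems.LacunarySymmetroidMatrixDescartes
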